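import Summits.BirchSwinnertonDyer.BirchSwinnertonDyer.Theorems.UniversalToricDescentThinCombTameRigidity
import Literature.NumberTheory.LocalFields.BinomialTwistExponentDenseValued
import Literature.NumberTheory.LocalFields.RestrictedPowerSeriesRecentering
import Literature.NumberTheory.LocalFields.RestrictedPowerSeriesInverse
import Literature.NumberTheory.LocalFields.BoundedPowerSeriesZeros
import HarnessLib

/-!
# Fibres of `R₀⟦T₁⟧⟦T₂⟧`-series as integral one-variable `ℂ_p`-series, re-centred at the nodes of a one-unit
# (bridge from the interpolation currency `UnrSeries.HasValueAt₂` to the tree's `p`-adic node theorems `Literature…LocalFields.*`)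
# (helper on the rational wall `RationalSplitIMCInclusionAtThree`, stmt-BirchSwinnertonDyer-24207, line `ratwall_thin_comb` v10;
# cell `pub/bsd-wall`, LEAD `cruxlead-24207` g37; `--supports stmt-BirchSwinnertonDyer-24207`; nothing is closed; BSD is not proved)

WHY THIS FILE. After SIZE and TAME rigidity (`…ThinComb.SizeRigidity`, `…ThinComb.TameRigidity`) the grading ratio `λ₀ = X·κ̂/Y` of a non-zero
♯♯-frame is `ζ·ν` with `ζ^m = 1` and `ν` a one-unit, and on every fibre `j` of the grid supply the values of `L₂` and of its reflection
`φ_{A_τ}L₂` at the nodes `c_j·u^{i} − 1` are proportional by `c·dⁱ`, `d = λ₀^{−m}`. The tree already holds the ONE-VARIABLE theorem that turns such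
node-proportional values into a binomial twist `(1+X)^z`, `z ∈ ℤ_p` (`Literature…LocalFields.PadicComplex.exists_padicInt_binomial_twist_of_node_values`,
Gouvêa §5.9 / Robert V.2.4, VI.2.1), for INTEGRAL series `f, g ∈ ℂ_p⟦X⟧` evaluated as `∑' n, [Xⁿ]f·xⁿ` at the nodes `uᵗ − 1`. This file supplies
the three bridges from the two-variable currency to that shape:

* §1 **`exists_fibreSeries`** — for `L ∈ R₀⟦T₁⟧⟦T₂⟧` and an inner value `‖y‖ < 1` there is an integral `F ∈ ℂ_p⟦X⟧` with
  `L(x, y) = ∑' n, [Xⁿ]F·xⁿ` for all `‖x‖ < 1` (the line `T₂ = y` through `UnrSeries.toInt₂`, `IntSeries.transpose`, `IntSeries.lineSubst`).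
* §2 **`exists_recenter_rescale`** — for an integral `F`, `0 < c < 1`, `‖ξ‖ ≤ c`, `‖a‖ ≤ 1`: an integral `H` with `H(x) = F(a·x + ξ)` on `‖x‖ ≤ c`
  (Robert VI.2.4 `exists_recenter` + `PowerSeries.rescale`; integrality of the re-centred coefficients `Σ_k C(k,m)a_kξ^{k−m}` is the
  ultrametric bound). With `ξ = a − 1` this moves the nodes `a·uᵗ − 1` of a fibre to the standard nodes `uᵗ − 1`.
* §3 **`exists_forall_le_ne_zero`** — an integral `F` with ONE non-zero value along an injective sequence of points of the closed disc `‖x‖ ≤ c < 1`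
  is non-zero at ALL points of the sequence beyond some index (finitely many zeros on the closed disc, `finite_zeros_closedBall_of_isRestricted`).

HONEST SCOPE: elementary non-archimedean analysis; nothing here is evidence that a toric frame exists at the additive split `3`;
24207 / 20395 / 20186 / 32493 OPEN; BSD is proved for no curve.

References: [cite: Robert2000PadicAnalysis, Ch. VI §2.4 Proposition (re-centring); Ch. VI §2.1–2.2 (zeros of restricted series)]
[cite: Gouvea1993PadicNumbers, §5.6 Cor. 5.6.3–5.6.4; §5.9] [cite: deShalit1987, II.4.17 (54) (lines of two-variable series)]
-/

set_option linter.dupNamespace false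
set_option autoImplicit false

noncomputable section

open Filter Topology PowerSeries

namespace Summit.BirchSwinnertonDyer.BirchSwinnertonDyer.Theorems.UniversalToricDescentThinComb.NodeSeries

open Literature.NumberTheory.EllipticCurves Literature.NumberTheory.LocalFields
open Summit.BirchSwinnertonDyer.Rank1Residual.X11b.UnrUnits (norm_natCast_le_one)

variable {p : ℕ} [Fact p.Prime]

/-! ### §1. The fibre of an `R₀⟦T₁⟧⟦T₂⟧`-series at an inner value, as an integral `ℂ_p⟦X⟧` -/

/-- **The fibre series.** For `L ∈ R₀⟦T₁⟧⟦T₂⟧` and an inner value `y` with `‖y‖ < 1` there is an integral one-variable series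
`F ∈ ℂ_p⟦X⟧` (`‖[Xⁿ]F‖ ≤ 1`) whose values `∑' n, [Xⁿ]F·xⁿ` are the values `L(x, y)` for all `‖x‖ < 1` — the line `T₂ = y` of `L`
(`[Xⁿ]F = Σ_k [T₁ⁿT₂ᵏ]L·yᵏ`). [cite: deShalit1987, II.4.17 (54) (p. 78)] [cite: Gouvea1993PadicNumbers, §5.6 Cor. 5.6.4] -/
theorem exists_fibreSeries (L : PowerSeries (UnrSeries p)) {y : ℂ_[p]} (hy : ‖y‖ < 1) :
    ∃ F : ℂ_[p]⟦X⟧, (∀ n, ‖coeff n F‖ ≤ 1) ∧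
      ∀ (x v : ℂ_[p]), ‖x‖ < 1 → (UnrSeries.HasValueAt₂ L x y v ↔ HasSum (fun n ↦ coeff n F * x ^ n) v) := by
  set yI : PadicComplexInt p := ⟨y, mem_padicComplexInt_iff.mpr hy.le⟩ with hyI
  set Q : PowerSeries (PadicComplexInt p) := IntSeries.lineSubst yI (IntSeries.transpose (UnrSeries.toInt₂ L)) with hQ
  refine ⟨PowerSeries.mk fun n ↦ ((coeff n Q : PadicComplexInt p) : ℂ_[p]), fun n ↦ ?_, fun x v hx ↦ ?_⟩
  · rw [coeff_mk]; exact mem_padicComplexInt_iff.mp (coeff n Q).2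
  · have hyI' : ‖(yI : ℂ_[p])‖ < 1 := hy
    rw [UnrSeries.hasValueAt₂_iff_toInt₂, ← IntSeries.hasValueAt₂_transpose_iff,
      ← IntSeries.hasValueAt_lineSubst_iff (G := IntSeries.transpose (UnrSeries.toInt₂ L)) hyI' hx]
    simp only [IntSeries.HasValueAt, coeff_mk, hQ]

/-! ### §2. Re-centring at a node and rescaling by a unit -/

/-- **Re-centre and rescale.** For an integral `F ∈ ℂ_p⟦X⟧`, `0 < c < 1`, `‖ξ‖ ≤ c` and `‖a‖ ≤ 1` there is an integral `H ∈ ℂ_p⟦X⟧` with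
`H(x) = F(a·x + ξ)` for all `‖x‖ ≤ c` (Robert VI.2.4: the expansion of `F` around `ξ` converges on the same closed disc and its coefficients
`Σ_k C(k,m)[Xᵏ]F·ξ^{k−m}` are integral; then `X ↦ aX`). [cite: Robert2000PadicAnalysis, Ch. VI §2.4 Proposition] -/
theorem exists_recenter_rescale {F : ℂ_[p]⟦X⟧} (hF : ∀ n, ‖coeff n F‖ ≤ 1) {c : ℝ} (hc0 : 0 < c) (hc1 : c < 1)
    {ξ a : ℂ_[p]} (hξ : ‖ξ‖ ≤ c) (ha : ‖a‖ ≤ 1) :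
    ∃ H : ℂ_[p]⟦X⟧, (∀ n, ‖coeff n H‖ ≤ 1) ∧
      ∀ x : ℂ_[p], ‖x‖ ≤ c → ∑' n, coeff n H * x ^ n = ∑' n, coeff n F * (a * x + ξ) ^ n := by
  have hres : IsRestricted c F := isRestricted_of_norm_coeff_le hF hc0.le hc1
  obtain ⟨g, -, hcoeff, -, heval⟩ := exists_recenter hc0 hres hξ
  refine ⟨rescale a g, fun n ↦ ?_, fun x hx ↦ ?_⟩
  · rw [coeff_rescale, norm_mul, norm_pow, hcoeff]
    have h1 : ‖∑' k, (k.choose n : ℂ_[p]) * coeff k F * ξ ^ (k - n)‖ ≤ 1 := by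
      refine IsUltrametricDist.norm_tsum_le_of_forall_le_of_nonneg zero_le_one fun k ↦ ?_
      rw [norm_mul, norm_mul, norm_pow]
      calc ‖(k.choose n : ℂ_[p])‖ * ‖coeff k F‖ * ‖ξ‖ ^ (k - n) ≤ 1 * 1 * 1 ^ (k - n) := by
            gcongr
            · exact norm_natCast_le_one _
            · exact hF k
            · exact hξ.trans hc1.le
        _ = 1 := by simp
    calc ‖a‖ ^ n * ‖∑' k, (k.choose n : ℂ_[p]) * coeff k F * ξ ^ (k - n)‖ ≤ 1 ^ n * 1 := by gcongr
      _ = 1 := by simp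
  · have hax : ‖a * x‖ ≤ c := by
      rw [norm_mul]; exact (mul_le_of_le_one_left (norm_nonneg _) ha).trans hx
    rw [← heval (a * x) hax]
    refine tsum_congr fun n ↦ ?_
    rw [coeff_rescale, mul_pow]
    ring

/-! ### §3. Finitely many zeros: non-vanishing beyond an index -/

/-- **Non-vanishing at almost all points of an injective sequence.** An integral `F ∈ ℂ_p⟦X⟧` with a non-zero value at one point of an
injective sequence `(xᵢ)` in the closed disc `‖x‖ ≤ c` (`0 < c < 1`) is non-zero at `xᵢ` for all `i ≥ i₁`, for some `i₁`: a non-zero series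
convergent on the closed disc has finitely many zeros there. [cite: Robert2000PadicAnalysis, Ch. VI §2.2 Theorem] -/
theorem exists_forall_le_ne_zero {F : ℂ_[p]⟦X⟧} (hF : ∀ n, ‖coeff n F‖ ≤ 1) {c : ℝ} (hc0 : 0 < c) (hc1 : c < 1)
    {x : ℕ → ℂ_[p]} (hinj : Function.Injective x) (hxc : ∀ i, ‖x i‖ ≤ c) {i₀ : ℕ}
    (h0 : ∑' n, coeff n F * x i₀ ^ n ≠ 0) :
    ∃ i₁ : ℕ, ∀ i, i₁ ≤ i → ∑' n, coeff n F * x i ^ n ≠ 0 := by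
  have hF0 : F ≠ 0 := fun h ↦ h0 (by simp [h])
  have hfin := finite_zeros_closedBall_of_isRestricted hc0 (isRestricted_of_norm_coeff_le hF hc0.le hc1) hF0
  have hpre : {i : ℕ | ∑' n, coeff n F * x i ^ n = 0}.Finite := by
    refine (hfin.preimage hinj.injOn).subset fun i hi ↦ ?_
    exact ⟨hxc i, hi⟩
  obtain ⟨i₁, hi₁⟩ := hpre.bddAbove
  refine ⟨i₁ + 1, fun i hi hzero ↦ ?_⟩
  have := hi₁ hzero
  omega

end Summit.BirchSwinnertonDyer.BirchSwinnertonDyer.Theorems.UniversalToricDescentThinComb.NodeSeries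

end
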